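import Mathlib
import Summits.ValiantsHypothesis.ValiantsHypothesis.Theorems.GrenetZeonDualUnipotentThreeHalvesWordDefs
import Summits.ValiantsHypothesis.ValiantsHypothesis.Theorems.GrenetZeonDualUnipotentThreeHalvesFlagCostRunBound
import Summits.ValiantsHypothesis.ValiantsHypothesis.Theorems.GrenetZeonTwoDimCoefficientsDualUnipotentTriangular

/-!
# POWER SIEVE — crux 24318 `DualUnipotentThreeHalves` in POWER currency (val-idea-31 g4, crux idea #3 `power-sieve`)

Status: VP≠VNP NOT proved; crux 24318 OPEN.  Nothing here is asserted as a law; the `def`s `SlowLaw` (= S3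
`SlowPlane` of `Lines/slow_planes|flag_cost|radical_split`, verbatim) and `HeavyTopSlowLaw` (R2 with its conclusion
moved from FLAG to POWER currency) are OPEN statements, typed only.

THE POINT.  The crux consumes ONLY the `(n-1)`-st POWER of the nilpotent pencil (`per_n = tr(N^{n-1}·M)`,
`radical_split :: exists_nilpotent_pencil_of_dualUnipotentRepr`, `dualUnipotentThreeHalves_of_slowPlane`).  A block of the
pencil all of whose VALUES satisfy `X^h = 0` with `h ≤ n-1` (pointwise SHORT; e.g. idea-30 g3's inflated block
`U_{h,k} = J_h ⊗ M_k ⊕ ℂ·R⊗1`, ✓ `Negative/InflatedReturns.infl_pow_four` for `h = 4`) is INVISIBLE to that power,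
whatever its words do.  Hence the ratio-knapsack pencils `E(n) = U_{h,k} ⊕ B_w(𝔫_d)` — which kill the FLAG-currency
sufficient conditions S3b `FlagCostLaw` / R2 `HeavyTopLaw` / α's `UniformWeightLaw` on paper — are SLOW with the trivial
certificate `K = N_lin⁻¹(U ⊕ 0)`, `k = 0` (§2, `slow_of_shortSummand`: kernel form for any pencil that is a direct sum of a
pointwise-short block and a block frozen by `K`).  §1 types the power currency (`Slow`, `SlowLaw`, `HeavyTopSlowLaw`) and
records FLAG ⇒ POWER (`slow_of_flagCheap` = ✓ `runBound` by name; `heavyTopSlowLaw_of_heavyTopLaw`).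
§2b (rev 2) is the typed ABSORPTION LEMMA for block-TRIANGULAR pencils with ARBITRARY affine glue:
`fromBlocks_triu_pow` (`[[A,G],[0,B]]^L`, corner `Σ_{a<L} A^a G B^{L-1-a}`), `totalDegree_pow_shortGlue_le` (short `A`,
any glue, any degree certificate `kB` for the powers of `B` along `v` ⇒ every entry of the power has `s`-degree
`≤ h + kB`), `slow_of_shortCorner` (⇒ `Slow` with budget `h + kB` on the same `K` when `(h + kB + 1)·n < dim K`): short
blocks and glue are absorbed ADDITIVELY and can never force a RATIO.  rev 2b (g4: `h ≤ L` dropped — the bound holds for every power).  §2c (rev 3): the general TOWER STEP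
`totalDegree_pow_triu_le` / `slow_of_triu` (certificates `k₁`, `k₂` for the two diagonal blocks, any affine glue ⇒
budget `k₁ + k₂ + 1`), with providers `shortCert` (`k = h-1`) and `frozenCert` (`k = 0`) — the induction step of the
successor stub ABSORB.  rev 3 2026-08-28 (g4); farm rc 0, 0 sorries.
Card: `Cruxes/DualUnipotentThreeHalves/Ideas/power-sieve.md`.
-/

set_option linter.dupNamespace false
set_option autoImplicit false

noncomputable section

namespace Summit.ValiantsHypothesis.ValiantsHypothesis.Cruxes.DualUnipotentThreeHalves.PowerSieve

open MvPolynomial Matrix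
open scoped BigOperators
open Summit.ValiantsHypothesis.ValiantsHypothesis.Cruxes.TwoDimCoefficients.DimTwoCases
  (AffMat IsAffine aeval_line_of_totalDegree_le_one totalDegree_aeval_line_le_one)
open Summit.ValiantsHypothesis.ValiantsHypothesis.Theorems.GrenetZeon.RadicalSplit
  (lineSubst flagDeg FlagAdapted FlagAdaptedUpTo FlagCheap RadOrth HeavyTopLaw)
open Summit.ValiantsHypothesis.ValiantsHypothesis.Theorems.GrenetZeon.FlagCost (runBound)

/-! ## §1 Power currency -/

/-- SLOW certificate for ONE pencil — the conclusion of S3 `SlowPlane`, verbatim: a direction space `K` and a budget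
`k` with `(k+1)·n < dim K` such that along every line `x + s·v`, `v ∈ K`, every entry of `N(x+sv)^{n-1}` has
`s`-degree `≤ k`. -/
def Slow (n m : ℕ) (N : AffMat n m) : Prop :=
  ∃ (K : Submodule ℂ (Fin n × Fin n → ℂ)) (k : ℕ),
    (∀ x v : Fin n × Fin n → ℂ, v ∈ K → ∀ i j : Fin m,
      ((((N.map (lineSubst x v)) ^ (n - 1)) i j).totalDegree ≤ k)) ∧
    (k + 1) * n < Module.finrank ℂ K

/-- S3 `SlowPlane` (OPEN law of lines `slow_planes`/`flag_cost`/`radical_split`), in the vocabulary `Slow`. -/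
def SlowLaw : Prop :=
  ∃ C₀ n₀ : ℕ, ∀ n ≥ n₀, ∀ m : ℕ, C₀ * m ^ 2 < n ^ 3 → ∀ N : AffMat n m, IsAffine N → N ^ m = 0 → Slow n m N

/-- **R2ᵖ — HEAVY-TOP SLOW LAW** (OPEN; R2 `HeavyTopLaw` with its conclusion moved from `FlagCheap` to `Slow`):
below `C₀m² < n³`, a nilpotent affine pencil all of whose trace-orthogonal direction spaces are small is SLOW.
E(n) satisfies its conclusion (§2); no counter-candidate is known.  Why it might fail: a LONG (pointwise nilindex ≥ n on
the part no cheap `K` freezes), coordinate-dense, ratio-forcing irreducible constituent inside the regime. -/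
def HeavyTopSlowLaw : Prop :=
  ∃ C₀ n₀ : ℕ, ∀ n ≥ n₀, ∀ m : ℕ, C₀ * m ^ 2 < n ^ 3 → ∀ N : AffMat n m, IsAffine N → N ^ m = 0 →
    (∀ K : Submodule ℂ (Fin n × Fin n → ℂ), RadOrth n m N K →
      Module.finrank ℂ K ≤ 16 * m * Nat.sqrt n + 16 * n) →
    Slow n m N

/-- FLAG ⇒ POWER for one pencil: ✓ `runBound` (S3a) by name. -/
theorem slow_of_flagCheap {n m : ℕ} (N : AffMat n m) (h : FlagCheap n m N) : Slow n m N :=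
  runBound n m N h

/-- R2 ⇒ R2ᵖ (so R2ᵖ is a WEAKER sufficient law feeding the same composition to the crux). -/
theorem heavyTopSlowLaw_of_heavyTopLaw (h : HeavyTopLaw) : HeavyTopSlowLaw := by
  obtain ⟨C₀, n₀, hC⟩ := h
  exact ⟨C₀, n₀, fun n hn m hm N hN hnil htop => slow_of_flagCheap N (hC n hn m hm N hN hnil htop)⟩

/-- `SlowLaw` ⇒ R2ᵖ trivially (R2ᵖ is the heavy-top CASE of S3). -/
theorem heavyTopSlowLaw_of_slowLaw (h : SlowLaw) : HeavyTopSlowLaw := by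
  obtain ⟨C₀, n₀, hC⟩ := h
  exact ⟨C₀, n₀, fun n hn m hm N hN hnil _ => hC n hn m hm N hN hnil⟩

/-! ## §2 Absorption: a pointwise-short summand is free, a frozen summand is free -/

section Absorption

variable {n : ℕ} {ι₁ ι₂ : Type} [Fintype ι₁] [Fintype ι₂] [DecidableEq ι₁] [DecidableEq ι₂]

/-- Powers of a block-diagonal matrix. -/
theorem fromBlocks_diag_pow {R : Type*} [CommRing R] (A : Matrix ι₁ ι₁ R) (B : Matrix ι₂ ι₂ R) (L : ℕ) :
    (fromBlocks A 0 0 B) ^ L = fromBlocks (A ^ L) 0 0 (B ^ L) := by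
  induction L with
  | zero => simp [fromBlocks_one]
  | succ L ih => rw [pow_succ, ih, fromBlocks_multiply]; simp [pow_succ]

/-- The linear-coefficient map of an (affine) block `B`: `v ↦ ((i,j) ↦ Σ_c v_c · [x_c] B_ij)`; its kernel is the space of
directions that FREEZE `B` (`B(x + s v) = B(x)`). -/
def linCoeff (B : Matrix ι₂ ι₂ (MvPolynomial (Fin n × Fin n) ℂ)) :
    (Fin n × Fin n → ℂ) →ₗ[ℂ] (ι₂ × ι₂ → ℂ) where
  toFun v := fun p => ∑ c, v c * coeff (Finsupp.single c 1) (B p.1 p.2)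
  map_add' v w := by
    ext p; simp only [Pi.add_apply, add_mul, Finset.sum_add_distrib]
  map_smul' a v := by
    ext p; simp only [Pi.smul_apply, smul_eq_mul, RingHom.id_apply, Finset.mul_sum, mul_assoc]

omit [Fintype ι₂] [DecidableEq ι₂] in
/-- Along a freezing direction the substituted block is CONSTANT in `s`. -/
theorem map_lineSubst_of_mem_ker (B : Matrix ι₂ ι₂ (MvPolynomial (Fin n × Fin n) ℂ))
    (hB : ∀ i j, (B i j).totalDegree ≤ 1) (x v : Fin n × Fin n → ℂ) (hv : v ∈ LinearMap.ker (linCoeff B)) :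
    B.map (lineSubst x v) = (B.map (MvPolynomial.eval x)).map C := by
  ext i j
  simp only [Matrix.map_apply]
  have hform := aeval_line_of_totalDegree_le_one x (fun _ : Fin 1 => v) (hB i j)
  have hz : ∑ c, v c * coeff (Finsupp.single c 1) (B i j) = 0 := by
    have := LinearMap.mem_ker.mp hv
    exact congrFun this (i, j)
  rw [show lineSubst x v (B i j) =
      aeval (fun c => (C (x c) + ∑ t : Fin 1, C (v c) * X t : MvPolynomial (Fin 1) ℂ)) (B i j) from rfl, hform]
  simp [hz]

/-- Entries of a matrix of constants have total degree `0`. -/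
theorem totalDegree_map_C_pow (P : Matrix ι₂ ι₂ ℂ) (L : ℕ) (i j : ι₂) :
    (((P.map (C : ℂ → MvPolynomial (Fin 1) ℂ)) ^ L) i j).totalDegree = 0 := by
  rw [show P.map (C : ℂ → MvPolynomial (Fin 1) ℂ) = (C : ℂ →+* MvPolynomial (Fin 1) ℂ).mapMatrix P from rfl,
    ← map_pow]
  simp [RingHom.mapMatrix_apply, Matrix.map_apply]

/-- **ABSORPTION (direct-sum form).**  If the pencil is `A ⊕ B` with `A` pointwise SHORT (`A^h = 0` as a polynomial
matrix, `h ≤ L`) and `v` FREEZES `B`, then EVERY entry of `(A ⊕ B)(x + s v)^L` has `s`-degree `0` — whatever the words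
of `A` do.  (E(n): `A = U_{h,k}`-block, `B` = band block, `L = n - 1 ≥ h`.) -/
theorem totalDegree_pow_shortSum_eq_zero (A : Matrix ι₁ ι₁ (MvPolynomial (Fin n × Fin n) ℂ))
    (B : Matrix ι₂ ι₂ (MvPolynomial (Fin n × Fin n) ℂ)) (h L : ℕ) (hA : A ^ h = 0) (hL : h ≤ L)
    (hB : ∀ i j, (B i j).totalDegree ≤ 1) (x v : Fin n × Fin n → ℂ) (hv : v ∈ LinearMap.ker (linCoeff B))
    (i j : ι₁ ⊕ ι₂) :
    ((((fromBlocks A 0 0 B).map (lineSubst x v)) ^ L) i j).totalDegree = 0 := by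
  have hApow : (A.map (lineSubst x v)) ^ L = 0 := by
    rw [show A.map (lineSubst x v) = (lineSubst x v).toRingHom.mapMatrix A from rfl, ← map_pow,
      show L = h + (L - h) by omega, pow_add, hA, zero_mul, map_zero]
  have h0 : (0 : Matrix ι₁ ι₂ (MvPolynomial (Fin n × Fin n) ℂ)).map (lineSubst x v) = 0 := by
    ext; simp
  have h0' : (0 : Matrix ι₂ ι₁ (MvPolynomial (Fin n × Fin n) ℂ)).map (lineSubst x v) = 0 := by
    ext; simp
  rw [Matrix.fromBlocks_map, h0, h0', fromBlocks_diag_pow, hApow, map_lineSubst_of_mem_ker B hB x v hv]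
  rcases i with i | i <;> rcases j with j | j
  · simp
  · simp
  · simp
  · simpa using totalDegree_map_C_pow (B.map (MvPolynomial.eval x)) L i j

/-! ### §2b Block-TRIANGULAR absorption (arbitrary affine glue) -/

/-- Powers of a block upper-triangular matrix: the corner is the glue sum `Σ_{a<L} A^a · G · B^{L-1-a}`. -/
theorem fromBlocks_triu_pow {R : Type*} [CommRing R] (A : Matrix ι₁ ι₁ R) (G : Matrix ι₁ ι₂ R)
    (B : Matrix ι₂ ι₂ R) (L : ℕ) :
    (fromBlocks A G 0 B) ^ L =
      fromBlocks (A ^ L) (∑ a ∈ Finset.range L, A ^ a * G * B ^ (L - 1 - a)) 0 (B ^ L) := by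
  induction L with
  | zero => simp [fromBlocks_one]
  | succ L ih =>
    have e2 : A ^ L * G + (∑ a ∈ Finset.range L, A ^ a * G * B ^ (L - 1 - a)) * B
        = ∑ a ∈ Finset.range (L + 1), A ^ a * G * B ^ (L + 1 - 1 - a) := by
      rw [Finset.sum_range_succ, show L + 1 - 1 - L = 0 from by omega, pow_zero, Matrix.mul_one, add_comm,
        Matrix.sum_mul]
      congr 1
      refine Finset.sum_congr rfl fun a ha => ?_
      rw [Finset.mem_range] at ha
      rw [Matrix.mul_assoc, ← pow_succ, show L - 1 - a + 1 = L + 1 - 1 - a from by omega]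
    rw [pow_succ, ih, fromBlocks_multiply, e2]
    simp only [Matrix.mul_zero, Matrix.zero_mul, add_zero, zero_add, ← pow_succ]

/-- Entrywise degree of a product. -/
theorem totalDegree_mul_apply_le {α β γ : Type} [Fintype β] {σ : Type}
    (P : Matrix α β (MvPolynomial σ ℂ)) (Q : Matrix β γ (MvPolynomial σ ℂ)) {p q : ℕ}
    (hP : ∀ i j, (P i j).totalDegree ≤ p) (hQ : ∀ i j, (Q i j).totalDegree ≤ q) (i : α) (j : γ) :
    ((P * Q) i j).totalDegree ≤ p + q := by
  rw [Matrix.mul_apply]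
  refine (totalDegree_finsetSum _ _).trans (Finset.sup_le fun k _ => ?_)
  exact (totalDegree_mul _ _).trans (add_le_add (hP i k) (hQ k j))

theorem totalDegree_one_apply {α : Type} [DecidableEq α] {σ : Type} (i j : α) :
    ((1 : Matrix α α (MvPolynomial σ ℂ)) i j).totalDegree = 0 := by
  rw [Matrix.one_apply]; split_ifs <;> simp

/-- Entries of the powers of a pointwise-SHORT affine block (`A^h = 0`, entries of degree `≤ 1`) have degree
`≤ h - 1`, uniformly in the exponent. -/
theorem totalDegree_pow_apply_le_of_short {α : Type} [Fintype α] [DecidableEq α] {σ : Type}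
    (A : Matrix α α (MvPolynomial σ ℂ)) (h : ℕ) (hA : A ^ h = 0) (hA1 : ∀ i j, (A i j).totalDegree ≤ 1)
    (a : ℕ) (i j : α) : ((A ^ a) i j).totalDegree ≤ h - 1 := by
  by_cases ha : a < h
  · have key : ∀ b : ℕ, ∀ i j, ((A ^ b) i j).totalDegree ≤ b := by
      intro b
      induction b with
      | zero => intro i j; rw [pow_zero]; exact (totalDegree_one_apply i j).le
      | succ b ih => intro i j; rw [pow_succ]; exact totalDegree_mul_apply_le _ _ ih hA1 i j
    exact (key a i j).trans (by omega)
  · have hz : A ^ a = 0 := by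
      rw [show a = h + (a - h) from by omega, pow_add, hA, zero_mul]
    rw [hz]; simp

/-- **ABSORPTION (block-triangular form, ARBITRARY affine glue `G`).**  If the pencil is block upper-triangular
`[[A, G], [0, B]]` with `A` pointwise SHORT (`A^h = 0`; no relation between `h` and `L` needed) and, along the
direction `v`, every power
`B(x+sv)^b` (`b ≤ L`) has entries of `s`-degree `≤ kB`, then every entry of the whole power has `s`-degree
`≤ h + kB`: the short block and the glue are absorbed ADDITIVELY (`+h`), never as a common ratio. -/
theorem totalDegree_pow_shortGlue_le
    (A : Matrix ι₁ ι₁ (MvPolynomial (Fin n × Fin n) ℂ)) (G : Matrix ι₁ ι₂ (MvPolynomial (Fin n × Fin n) ℂ))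
    (B : Matrix ι₂ ι₂ (MvPolynomial (Fin n × Fin n) ℂ)) (h L kB : ℕ) (hA : A ^ h = 0)
    (hA1 : ∀ i j, (A i j).totalDegree ≤ 1) (hG1 : ∀ i j, (G i j).totalDegree ≤ 1)
    (x v : Fin n × Fin n → ℂ)
    (hB : ∀ b ≤ L, ∀ i j, (((B.map (lineSubst x v)) ^ b) i j).totalDegree ≤ kB)
    (i j : ι₁ ⊕ ι₂) :
    ((((fromBlocks A G 0 B).map (lineSubst x v)) ^ L) i j).totalDegree ≤ h + kB := by
  have h0 : (0 : Matrix ι₂ ι₁ (MvPolynomial (Fin n × Fin n) ℂ)).map (lineSubst x v) = 0 := by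
    ext; simp
  rw [Matrix.fromBlocks_map, h0, fromBlocks_triu_pow]
  set A' := A.map (lineSubst x v) with hA'
  set G' := G.map (lineSubst x v) with hG'
  set B' := B.map (lineSubst x v) with hB'
  have hA'h : A' ^ h = 0 := by
    rw [hA', show A.map (lineSubst x v) = (lineSubst x v).toRingHom.mapMatrix A from rfl, ← map_pow, hA,
      map_zero]
  have hA'1 : ∀ i j, (A' i j).totalDegree ≤ 1 := fun i j => by
    rw [hA', Matrix.map_apply]
    exact totalDegree_aeval_line_le_one x (fun _ : Fin 1 => v) (hA1 i j)
  have hG'1 : ∀ i j, (G' i j).totalDegree ≤ 1 := fun i j => by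
    rw [hG', Matrix.map_apply]
    exact totalDegree_aeval_line_le_one x (fun _ : Fin 1 => v) (hG1 i j)
  have hApow : ∀ a i j, ((A' ^ a) i j).totalDegree ≤ h - 1 :=
    totalDegree_pow_apply_le_of_short A' h hA'h hA'1
  rcases i with i | i <;> rcases j with j | j
  · rw [fromBlocks_apply₁₁]
    exact (hApow L i j).trans (by omega)
  · have hh1 : 1 ≤ h := by
      rcases Nat.eq_zero_or_pos h with rfl | hpos
      · exact absurd (congrFun (congrFun hA'h i) i) (by simp)
      · exact hpos
    rw [fromBlocks_apply₁₂, Matrix.sum_apply]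
    refine (totalDegree_finsetSum _ _).trans (Finset.sup_le fun a ha => ?_)
    rw [Finset.mem_range] at ha
    calc ((A' ^ a * G' * B' ^ (L - 1 - a)) i j).totalDegree ≤ ((h - 1) + 1) + kB :=
          totalDegree_mul_apply_le _ _ (fun i' j' => totalDegree_mul_apply_le _ _ (hApow a) hG'1 i' j')
            (hB (L - 1 - a) (by omega)) i j
      _ ≤ h + kB := by omega
  · simp
  · rw [fromBlocks_apply₂₂]
    exact (hB L le_rfl i j).trans (by omega)

/-! ### §2c TOWER STEP — general two-block absorption with certificates (the ABSORB induction step) -/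

/-- Certificate of a pointwise-SHORT affine block along any line: all powers have entries of `s`-degree `≤ h - 1`. -/
theorem shortCert (A : Matrix ι₁ ι₁ (MvPolynomial (Fin n × Fin n) ℂ)) (h : ℕ) (hA : A ^ h = 0)
    (hA1 : ∀ i j, (A i j).totalDegree ≤ 1) (x v : Fin n × Fin n → ℂ) (b : ℕ) (i j : ι₁) :
    ((((A.map (lineSubst x v)) ^ b) i j).totalDegree) ≤ h - 1 := by
  have hA'h : (A.map (lineSubst x v)) ^ h = 0 := by
    rw [show A.map (lineSubst x v) = (lineSubst x v).toRingHom.mapMatrix A from rfl, ← map_pow, hA, map_zero]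
  have hA'1 : ∀ i j, ((A.map (lineSubst x v)) i j).totalDegree ≤ 1 := fun i j => by
    rw [Matrix.map_apply]
    exact totalDegree_aeval_line_le_one x (fun _ : Fin 1 => v) (hA1 i j)
  exact totalDegree_pow_apply_le_of_short _ h hA'h hA'1 b i j

/-- Certificate of a FROZEN affine block (`v` kills its linear part): all powers have entries of `s`-degree `0`. -/
theorem frozenCert (B : Matrix ι₂ ι₂ (MvPolynomial (Fin n × Fin n) ℂ)) (hB : ∀ i j, (B i j).totalDegree ≤ 1)
    (x v : Fin n × Fin n → ℂ) (hv : v ∈ LinearMap.ker (linCoeff B)) (b : ℕ) (i j : ι₂) :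
    ((((B.map (lineSubst x v)) ^ b) i j).totalDegree) ≤ 0 := by
  rw [map_lineSubst_of_mem_ker B hB x v hv]
  exact (totalDegree_map_C_pow (B.map (MvPolynomial.eval x)) b i j).le

/-- **TOWER STEP (general two-block absorption).**  For a block upper-triangular affine pencil `[[B₁, G], [0, B₂]]`
and a direction `v`: if every power of `B₁(x+sv)` has entries of `s`-degree `≤ k₁` and every power `B₂(x+sv)^b`,
`b ≤ L`, has entries of `s`-degree `≤ k₂`, then every entry of the `L`-th power of the whole has `s`-degree
`≤ k₁ + k₂ + 1` (the glue is crossed at most once: `+1`).  Short blocks: `k = h - 1` (`shortCert`); frozen blocks: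
`k = 0` (`frozenCert`); flag-certified blocks: `k = flagDeg` (✓ `runBound`'s proof).  Iterating down a chain of
invariant subspaces gives budget `Σ kᵢ + (#blocks - 1)` on the common `K` — the ABSORB stub of `slow_core`. -/
theorem totalDegree_pow_triu_le
    (B₁ : Matrix ι₁ ι₁ (MvPolynomial (Fin n × Fin n) ℂ)) (G : Matrix ι₁ ι₂ (MvPolynomial (Fin n × Fin n) ℂ))
    (B₂ : Matrix ι₂ ι₂ (MvPolynomial (Fin n × Fin n) ℂ)) (L k₁ k₂ : ℕ)
    (hG1 : ∀ i j, (G i j).totalDegree ≤ 1) (x v : Fin n × Fin n → ℂ)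
    (h₁ : ∀ b, ∀ i j, (((B₁.map (lineSubst x v)) ^ b) i j).totalDegree ≤ k₁)
    (h₂ : ∀ b ≤ L, ∀ i j, (((B₂.map (lineSubst x v)) ^ b) i j).totalDegree ≤ k₂)
    (i j : ι₁ ⊕ ι₂) :
    ((((fromBlocks B₁ G 0 B₂).map (lineSubst x v)) ^ L) i j).totalDegree ≤ k₁ + k₂ + 1 := by
  have h0 : (0 : Matrix ι₂ ι₁ (MvPolynomial (Fin n × Fin n) ℂ)).map (lineSubst x v) = 0 := by
    ext; simp
  rw [Matrix.fromBlocks_map, h0, fromBlocks_triu_pow]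
  have hG'1 : ∀ i j, ((G.map (lineSubst x v)) i j).totalDegree ≤ 1 := fun i j => by
    rw [Matrix.map_apply]
    exact totalDegree_aeval_line_le_one x (fun _ : Fin 1 => v) (hG1 i j)
  rcases i with i | i <;> rcases j with j | j
  · rw [fromBlocks_apply₁₁]
    exact (h₁ L i j).trans (by omega)
  · rw [fromBlocks_apply₁₂, Matrix.sum_apply]
    refine (totalDegree_finsetSum _ _).trans (Finset.sup_le fun a ha => ?_)
    rw [Finset.mem_range] at ha
    calc (((B₁.map (lineSubst x v)) ^ a * G.map (lineSubst x v) * (B₂.map (lineSubst x v)) ^ (L - 1 - a)) i j).totalDegree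
          ≤ (k₁ + 1) + k₂ :=
          totalDegree_mul_apply_le _ _ (fun i' j' => totalDegree_mul_apply_le _ _ (h₁ a) hG'1 i' j')
            (h₂ (L - 1 - a) (by omega)) i j
      _ ≤ k₁ + k₂ + 1 := by omega
  · simp
  · rw [fromBlocks_apply₂₂]
    exact (h₂ L le_rfl i j).trans (by omega)

end Absorption

/-! ## §3 E(n)-shape pencils are SLOW -/

/-- **E(n)-SHAPE PENCILS ARE SLOW.**  An `m × m` affine pencil which, after a re-indexing of `Fin m`, is a direct sum
`A ⊕ B` with `A` pointwise short (`A^h = 0`, `h ≤ n - 1`) and whose `B`-freezing directions have dimension `> n` is SLOW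
with budget `k = 0`.  For idea-30 g3's `E(n) = U_{h,k} ⊕ B_w(𝔫_d)`: `A^h = 0` by the `S_{a,b} = 0` identities of the
nilpotent plane `{J_h, R}` (✓ `infl_pow_four`, h = 4), `n - 1 ≥ h` in its regime `n ≥ 16C₀h²`, and the freezing space is
`N_lin⁻¹(U ⊕ 0)` of dimension `k²+1 ≥ ¾n² > n`.  So E(n) meets the conclusion of S3 / R2ᵖ. -/
theorem slow_of_shortSummand {n m : ℕ} {ι₁ ι₂ : Type} [Fintype ι₁] [Fintype ι₂] [DecidableEq ι₁] [DecidableEq ι₂]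
    (N : AffMat n m) (e : ι₁ ⊕ ι₂ ≃ Fin m)
    (A : Matrix ι₁ ι₁ (MvPolynomial (Fin n × Fin n) ℂ)) (B : Matrix ι₂ ι₂ (MvPolynomial (Fin n × Fin n) ℂ))
    (hN : N = Matrix.reindex e e (fromBlocks A 0 0 B))
    (h : ℕ) (hA : A ^ h = 0) (hh : h ≤ n - 1) (hB : ∀ i j, (B i j).totalDegree ≤ 1)
    (hdim : n < Module.finrank ℂ (LinearMap.ker (linCoeff B))) :
    Slow n m N := by
  refine ⟨LinearMap.ker (linCoeff B), 0, ?_, by simpa using hdim⟩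
  intro x v hv i j
  have h1 : N.map (lineSubst x v) = Matrix.reindex e e ((fromBlocks A 0 0 B).map (lineSubst x v)) := by
    rw [hN]; ext a b; simp [Matrix.reindex_apply, Matrix.map_apply]
  have hre : (N.map (lineSubst x v)) ^ (n - 1) =
      Matrix.reindex e e (((fromBlocks A 0 0 B).map (lineSubst x v)) ^ (n - 1)) := by
    rw [h1, ← Matrix.reindexAlgEquiv_apply ℂ (MvPolynomial (Fin 1) ℂ) e,
      ← Matrix.reindexAlgEquiv_apply ℂ (MvPolynomial (Fin 1) ℂ) e, map_pow]
  rw [hre, Matrix.reindex_apply, Matrix.submatrix_apply]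
  exact le_of_eq (totalDegree_pow_shortSum_eq_zero A B h (n - 1) hA hh hB x v hv _ _)

/-- **BLOCK-TRIANGULAR PENCILS WITH A SHORT CORNER ARE SLOW (typed ABSORPTION LEMMA).**  If, after re-indexing,
`N = [[A, G], [0, B]]` with `A` pointwise short (`A^h = 0`), arbitrary affine glue `G`, and `B` admits
ANY degree certificate of budget `kB` along a direction space `K` (e.g. a flag certificate via ✓ `runBound`, or
`kB = 0` when `K` freezes `B`), then `N` is SLOW with budget `h + kB` on the same `K` — provided
`(h + kB + 1)·n < dim K`.  Short blocks and glue cost `+h` ADDITIVELY; they can never force a RATIO. -/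
theorem slow_of_shortCorner {n m : ℕ} {ι₁ ι₂ : Type} [Fintype ι₁] [Fintype ι₂] [DecidableEq ι₁] [DecidableEq ι₂]
    (N : AffMat n m) (e : ι₁ ⊕ ι₂ ≃ Fin m)
    (A : Matrix ι₁ ι₁ (MvPolynomial (Fin n × Fin n) ℂ)) (G : Matrix ι₁ ι₂ (MvPolynomial (Fin n × Fin n) ℂ))
    (B : Matrix ι₂ ι₂ (MvPolynomial (Fin n × Fin n) ℂ))
    (hN : N = Matrix.reindex e e (fromBlocks A G 0 B))
    (h : ℕ) (hA : A ^ h = 0)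
    (hA1 : ∀ i j, (A i j).totalDegree ≤ 1) (hG1 : ∀ i j, (G i j).totalDegree ≤ 1)
    (K : Submodule ℂ (Fin n × Fin n → ℂ)) (kB : ℕ)
    (hK : ∀ x v : Fin n × Fin n → ℂ, v ∈ K → ∀ b ≤ n - 1, ∀ i j,
      (((B.map (lineSubst x v)) ^ b) i j).totalDegree ≤ kB)
    (hdim : (h + kB + 1) * n < Module.finrank ℂ K) :
    Slow n m N := by
  refine ⟨K, h + kB, ?_, hdim⟩
  intro x v hv i j
  have h1 : N.map (lineSubst x v) = Matrix.reindex e e ((fromBlocks A G 0 B).map (lineSubst x v)) := by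
    rw [hN]; ext a b; simp [Matrix.reindex_apply, Matrix.map_apply]
  have hre : (N.map (lineSubst x v)) ^ (n - 1) =
      Matrix.reindex e e (((fromBlocks A G 0 B).map (lineSubst x v)) ^ (n - 1)) := by
    rw [h1, ← Matrix.reindexAlgEquiv_apply ℂ (MvPolynomial (Fin 1) ℂ) e,
      ← Matrix.reindexAlgEquiv_apply ℂ (MvPolynomial (Fin 1) ℂ) e, map_pow]
  rw [hre, Matrix.reindex_apply, Matrix.submatrix_apply]
  exact totalDegree_pow_shortGlue_le A G B h (n - 1) kB hA hA1 hG1 x v (hK x v hv) _ _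

/-- **SLOW TOWER STEP.**  `N = [[B₁, G], [0, B₂]]` (after re-indexing) with power certificates `k₁` (all powers of
`B₁`) and `k₂` (powers `≤ n-1` of `B₂`) along a common direction space `K` is SLOW with budget `k₁ + k₂ + 1` once
`(k₁ + k₂ + 2)·n < dim K`.  With `shortCert` / `frozenCert` this specialises to `slow_of_shortCorner` /
`slow_of_shortSummand`; it is the induction step of the successor stub ABSORB (composition-series form). -/
theorem slow_of_triu {n m : ℕ} {ι₁ ι₂ : Type} [Fintype ι₁] [Fintype ι₂] [DecidableEq ι₁] [DecidableEq ι₂]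
    (N : AffMat n m) (e : ι₁ ⊕ ι₂ ≃ Fin m)
    (B₁ : Matrix ι₁ ι₁ (MvPolynomial (Fin n × Fin n) ℂ)) (G : Matrix ι₁ ι₂ (MvPolynomial (Fin n × Fin n) ℂ))
    (B₂ : Matrix ι₂ ι₂ (MvPolynomial (Fin n × Fin n) ℂ))
    (hN : N = Matrix.reindex e e (fromBlocks B₁ G 0 B₂))
    (hG1 : ∀ i j, (G i j).totalDegree ≤ 1)
    (K : Submodule ℂ (Fin n × Fin n → ℂ)) (k₁ k₂ : ℕ)
    (hK₁ : ∀ x v : Fin n × Fin n → ℂ, v ∈ K → ∀ b, ∀ i j,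
      (((B₁.map (lineSubst x v)) ^ b) i j).totalDegree ≤ k₁)
    (hK₂ : ∀ x v : Fin n × Fin n → ℂ, v ∈ K → ∀ b ≤ n - 1, ∀ i j,
      (((B₂.map (lineSubst x v)) ^ b) i j).totalDegree ≤ k₂)
    (hdim : (k₁ + k₂ + 2) * n < Module.finrank ℂ K) :
    Slow n m N := by
  refine ⟨K, k₁ + k₂ + 1, ?_, by simpa [add_assoc] using hdim⟩
  intro x v hv i j
  have h1 : N.map (lineSubst x v) = Matrix.reindex e e ((fromBlocks B₁ G 0 B₂).map (lineSubst x v)) := by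
    rw [hN]; ext a b; simp [Matrix.reindex_apply, Matrix.map_apply]
  have hre : (N.map (lineSubst x v)) ^ (n - 1) =
      Matrix.reindex e e (((fromBlocks B₁ G 0 B₂).map (lineSubst x v)) ^ (n - 1)) := by
    rw [h1, ← Matrix.reindexAlgEquiv_apply ℂ (MvPolynomial (Fin 1) ℂ) e,
      ← Matrix.reindexAlgEquiv_apply ℂ (MvPolynomial (Fin 1) ℂ) e, map_pow]
  rw [hre, Matrix.reindex_apply, Matrix.submatrix_apply]
  exact totalDegree_pow_triu_le B₁ G B₂ (n - 1) k₁ k₂ hG1 x v (hK₁ x v hv) (hK₂ x v hv) _ _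

end Summit.ValiantsHypothesis.ValiantsHypothesis.Cruxes.DualUnipotentThreeHalves.PowerSieve
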